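import Mathlib
import HarnessLib
import Summits.ValiantsHypothesis.ValiantsHypothesis.Theorems.LacunarySymmetroidMatrixDescartesProductPlusOneWronskianSharp

/-!
# LINE (A) `product_plus_one` — W-CB / the TWO-BUMP LAW (memo §22.3) is SHARP: two knee rows of DIFFERENT rates give FOUR zeros of
# `W(∏ f_j)` in ONE pole-free window (pen val-idea-25 g4 brick B-SHARP2, 05:59Z 2026-08-29)

Crux item stmt-ValiantsHypothesis-18050 (`MatrixDescartes`, V1), LINE (A) `product_plus_one`, W-currency (`W(P) = P·θ(θP) − (θP)²`, `θ = X·d/dX`).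
Owner memo `pub/ideators/val-idea-25/NOTE-idea25g3-18050-LINEA-AB-reduction.md` §22.3 (PURE 2N-LAW, located: N bump rows ⇒ ≤ 2N zeros of `W` per
pole-free window, 0 violations in ≈ 2.2·10⁴ windows, 2N attained for N ≤ 3 in floats) and §21.2/§22.5 (N = 1 = ✓ the one-bump cells; N = 2 = the first
OPEN cell, the «two-bump law»).  This file is the kernel-certified SHARPNESS DATUM for N = 2, in the pattern of ✓ `wronskianSharp_six_zeros`
(✓ `…WronskianSharp`: exact rational sign evaluations + IVT), for TWO binomial companies on the support `d = (0, 1, 6)`: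

* §1 ★ `wronskianSharpTwoBump_slowFast_four_zeros` — THE {SLOW, FAST} CELL of the pen's pointer (bus 05:59Z (5)): rows `f₀ = 1 − 100x` (one-change, pole at
  `x = 10⁻²`, rate 1), `f₁ = 1 + 10x` (SLOW knee, rate 1), `f₂ = 1 + 10⁻¹⁹x⁶` (FAST knee, rate 6), `f₃ = 1 − 10⁻⁵x` (pole at `x = 10⁵`, rate 1) — every pole
  rate `≥` the slow rate; exact signs of `W(∏ f_j)` at `t = 1/50, 1, 100, 10³, 10⁴` are `− + − + −` (`wsharpB_signs`), hence FOUR distinct zeros in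
  `(1/50, 10⁴) ⊂ (10⁻², 10⁵)`, the pole-free window: ONE fast knee among a slow knee and poles of rate ≥ the slow rate costs the full `+2`
  (✓ `…SlowKneeCloudCell`: slow knees alone cost ≤ 2), so a «≤ 4» for this cell cannot be lowered;
* §2 ★ `wronskianSharpTwoBump_fastFast_four_zeros` — TWO FAST knees of DIFFERENT rates against a slower pole: rows `g₀ = 1 + 10⁻¹x⁶` (knee, rate 6),
  `g₁ = x + 10⁻¹⁰x⁶` (knee, rate 5), `g₂ = 1 − 10⁻⁴x` (pole at `x = 10⁴`, rate 1); exact signs at `t = 10⁻³, 1, 10, 10², 10³` are `− + − + −`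
  (`wsharpA_signs`), hence FOUR distinct zeros in `(10⁻³, 10³) ⊂ (0, 10⁴)`, the pole-free window (`g₁(0) = 0` is the window's end, not inside it).

Located first in floats (pure model `Φ = Σ_knees w s²σ − Σ_poles w r²κ`, this seat's `work/bsharp2/search*.py`, zeros ≈ 0.061, 95, 303, 4.4·10³ resp.
≈ 0.12, 8.9, 14, 3.6·10²), then certified EXACTLY (`fractions`) at the five rational points before typing; the kernel proof is `norm_num` on closed forms.
Lemmas `wsharpB_rows_eval` / `wsharpB_rowW_eval` / `wsharpB_W_eval` (§1) and `wsharpA_…` (§2) are the row values, the row log-Wronskians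
(✓ `eval_fewnomial`, ✓ `eval_logWronskian_fewnomial`) and `W(P)(t) = P(t)²·Σ_j W(f_j)(t)/f_j(t)²` off the rows' zeros (✓ `theta_wronskian_prod`,
✓ `wronskian_sum_eq_prod_sq_mul`), exactly as in ✓ `…WronskianSharp`.

HONEST FRAMING: two explicit members, kernel-evaluated; a located LOWER-BOUND datum («≥ 4 = 2N at N = 2, mixed rates») on the constant of the CONJECTURED
two-bump law / PURE 2N-LAW (memo §22.3) — it proves no upper bound, is not a stub, and closes nothing; `WronskianBudgetK3` / `OneChangeFloorK3` /
`stub_classRowK3` / `stub_eulerBoundK3` / `stub_polyLaw` / 18050 / `MatrixDescartes` OPEN; `VP ≠ VNP` NOT proved.  No definitions, no named facts;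
Mathlib + ✓ `…WronskianSharp` (for ✓ `…LetterVariance` / ✓ `…LogWronskianSigns`) only.
-/

set_option linter.dupNamespace false

namespace Summit.ValiantsHypothesis.ValiantsHypothesis.Theorems.LacunarySymmetroidMatrixDescartes

namespace ProductPlusOne

open Polynomial Finset
open scoped BigOperators

/-! ### §1 The {slow, fast} cell: `(1 − 100x)(1 + 10x)(1 + 10⁻¹⁹x⁶)(1 − 10⁻⁵x)` — four zeros of `W` in the pole-free window `(10⁻², 10⁵)` -/

/-- The rows of the member at a point. [this file's lemma] -/
theorem wsharpB_rows_eval (t : ℝ) (j : Fin 4) :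
    (∑ l, C ((![![(1 : ℝ), -100, 0], ![1, 10, 0], ![1, 0, 1 / 10 ^ 19], ![1, -1 / 10 ^ 5, 0]] : Fin 4 → Fin 3 → ℝ) j l)
        * X ^ ((![0, 1, 6] : Fin 3 → ℕ) l) : ℝ[X]).eval t
      = (![1 - 100 * t, 1 + 10 * t, 1 + t ^ 6 / 10 ^ 19, 1 - t / 10 ^ 5] : Fin 4 → ℝ) j := by
  rw [eval_fewnomial]
  fin_cases j
  all_goals (simp [Fin.sum_univ_three] <;> ring)

/-- The rows' log-Wronskians at a point. [this file's lemma] -/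
theorem wsharpB_rowW_eval (t : ℝ) (j : Fin 4) :
    ((∑ l, C ((![![(1 : ℝ), -100, 0], ![1, 10, 0], ![1, 0, 1 / 10 ^ 19], ![1, -1 / 10 ^ 5, 0]]
            : Fin 4 → Fin 3 → ℝ) j l) * X ^ ((![0, 1, 6] : Fin 3 → ℕ) l) : ℝ[X])
        * (X * derivative (X * derivative (∑ l, C ((![![(1 : ℝ), -100, 0], ![1, 10, 0], ![1, 0, 1 / 10 ^ 19], ![1, -1 / 10 ^ 5, 0]]
            : Fin 4 → Fin 3 → ℝ) j l) * X ^ ((![0, 1, 6] : Fin 3 → ℕ) l) : ℝ[X])))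
        - (X * derivative (∑ l, C ((![![(1 : ℝ), -100, 0], ![1, 10, 0], ![1, 0, 1 / 10 ^ 19], ![1, -1 / 10 ^ 5, 0]]
            : Fin 4 → Fin 3 → ℝ) j l) * X ^ ((![0, 1, 6] : Fin 3 → ℕ) l) : ℝ[X])) ^ 2).eval t
      = (![-100 * t, 10 * t, 36 * t ^ 6 / 10 ^ 19, -t / 10 ^ 5] : Fin 4 → ℝ) j := by
  rw [eval_logWronskian_fewnomial]
  fin_cases j <;> (simp [Fin.sum_univ_three]; ring)

/-- **`W(P)(t) = P(t)²·Σ_j W(f_j)(t)/f_j(t)²`** for the member at any `t` where no row vanishes (`10⁻² < t < 10⁵` suffices). [this file's lemma] -/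
theorem wsharpB_W_eval {t : ℝ} (ht0 : 1 / 100 < t) (ht : t < 10 ^ 5) :
    ((∏ j, ∑ l, C ((![![(1 : ℝ), -100, 0], ![1, 10, 0], ![1, 0, 1 / 10 ^ 19], ![1, -1 / 10 ^ 5, 0]] : Fin 4 → Fin 3 → ℝ) j l)
          * X ^ ((![0, 1, 6] : Fin 3 → ℕ) l) : ℝ[X])
        * (X * derivative (X * derivative (∏ j, ∑ l, C ((![![(1 : ℝ), -100, 0], ![1, 10, 0], ![1, 0, 1 / 10 ^ 19], ![1, -1 / 10 ^ 5, 0]]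
            : Fin 4 → Fin 3 → ℝ) j l) * X ^ ((![0, 1, 6] : Fin 3 → ℕ) l) : ℝ[X])))
        - (X * derivative (∏ j, ∑ l, C ((![![(1 : ℝ), -100, 0], ![1, 10, 0], ![1, 0, 1 / 10 ^ 19], ![1, -1 / 10 ^ 5, 0]]
            : Fin 4 → Fin 3 → ℝ) j l) * X ^ ((![0, 1, 6] : Fin 3 → ℕ) l) : ℝ[X])) ^ 2).eval t
      = ((1 - 100 * t) * (1 + 10 * t) * (1 + t ^ 6 / 10 ^ 19) * (1 - t / 10 ^ 5)) ^ 2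
        * ((-100 * t) / (1 - 100 * t) ^ 2 + (10 * t) / (1 + 10 * t) ^ 2
            + (36 * t ^ 6 / 10 ^ 19) / (1 + t ^ 6 / 10 ^ 19) ^ 2 + (-t / 10 ^ 5) / (1 - t / 10 ^ 5) ^ 2) := by
  have hf : ∀ j, (∑ l, C ((![![(1 : ℝ), -100, 0], ![1, 10, 0], ![1, 0, 1 / 10 ^ 19], ![1, -1 / 10 ^ 5, 0]] : Fin 4 → Fin 3 → ℝ) j l)
        * X ^ ((![0, 1, 6] : Fin 3 → ℕ) l) : ℝ[X]).eval t ≠ 0 := by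
    intro j
    rw [wsharpB_rows_eval]
    have h6 : 0 ≤ t ^ 6 := by positivity
    fin_cases j <;> simp <;> intro h <;> nlinarith
  have h := congrArg (Polynomial.eval t) (theta_wronskian_prod (fun j => (∑ l, C ((![![(1 : ℝ), -100, 0], ![1, 10, 0], ![1, 0, 1 / 10 ^ 19], ![1, -1 / 10 ^ 5, 0]]
      : Fin 4 → Fin 3 → ℝ) j l) * X ^ ((![0, 1, 6] : Fin 3 → ℕ) l) : ℝ[X])))
  rw [eval_finsetSum] at h
  simp only [eval_mul, eval_prod, eval_pow] at h
  rw [h, wronskian_sum_eq_prod_sq_mul _ hf, eval_prod]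
  simp only [wsharpB_rows_eval, wsharpB_rowW_eval]
  simp only [Fin.prod_univ_four, Fin.sum_univ_four, Matrix.cons_val_zero, Matrix.cons_val_one, Matrix.cons_val_two, Matrix.cons_val_three,
    Matrix.head_cons, Matrix.tail_cons]

/-- Exact signs of `W(∏ f_j)` at the five points `1 / 50, 1, 100, 1000, 10000`: `− + − + −`. [this file's lemma] -/
theorem wsharpB_signs :
    (∀ t ∈ ({1 / 50, 100, 10000} : Set ℝ),
      ((∏ j, ∑ l, C ((![![(1 : ℝ), -100, 0], ![1, 10, 0], ![1, 0, 1 / 10 ^ 19], ![1, -1 / 10 ^ 5, 0]] : Fin 4 → Fin 3 → ℝ) j l)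
          * X ^ ((![0, 1, 6] : Fin 3 → ℕ) l) : ℝ[X])
        * (X * derivative (X * derivative (∏ j, ∑ l, C ((![![(1 : ℝ), -100, 0], ![1, 10, 0], ![1, 0, 1 / 10 ^ 19], ![1, -1 / 10 ^ 5, 0]]
            : Fin 4 → Fin 3 → ℝ) j l) * X ^ ((![0, 1, 6] : Fin 3 → ℕ) l) : ℝ[X])))
        - (X * derivative (∏ j, ∑ l, C ((![![(1 : ℝ), -100, 0], ![1, 10, 0], ![1, 0, 1 / 10 ^ 19], ![1, -1 / 10 ^ 5, 0]]
            : Fin 4 → Fin 3 → ℝ) j l) * X ^ ((![0, 1, 6] : Fin 3 → ℕ) l) : ℝ[X])) ^ 2).eval t < 0) ∧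
    (∀ t ∈ ({1, 1000} : Set ℝ), 0 <
      ((∏ j, ∑ l, C ((![![(1 : ℝ), -100, 0], ![1, 10, 0], ![1, 0, 1 / 10 ^ 19], ![1, -1 / 10 ^ 5, 0]] : Fin 4 → Fin 3 → ℝ) j l)
          * X ^ ((![0, 1, 6] : Fin 3 → ℕ) l) : ℝ[X])
        * (X * derivative (X * derivative (∏ j, ∑ l, C ((![![(1 : ℝ), -100, 0], ![1, 10, 0], ![1, 0, 1 / 10 ^ 19], ![1, -1 / 10 ^ 5, 0]]
            : Fin 4 → Fin 3 → ℝ) j l) * X ^ ((![0, 1, 6] : Fin 3 → ℕ) l) : ℝ[X])))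
        - (X * derivative (∏ j, ∑ l, C ((![![(1 : ℝ), -100, 0], ![1, 10, 0], ![1, 0, 1 / 10 ^ 19], ![1, -1 / 10 ^ 5, 0]]
            : Fin 4 → Fin 3 → ℝ) j l) * X ^ ((![0, 1, 6] : Fin 3 → ℕ) l) : ℝ[X])) ^ 2).eval t) := by
  constructor
  · intro t ht
    simp only [Set.mem_insert_iff, Set.mem_singleton_iff] at ht
    rcases ht with rfl | rfl | rfl <;> (rw [wsharpB_W_eval (by norm_num) (by norm_num)]; norm_num)
  · intro t ht
    simp only [Set.mem_insert_iff, Set.mem_singleton_iff] at ht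
    rcases ht with rfl | rfl <;> (rw [wsharpB_W_eval (by norm_num) (by norm_num)]; norm_num)

/-- ★ **THE TWO-BUMP LAW IS SHARP IN THE {SLOW, FAST} CELL: FOUR zeros of `W(∏_j fewnomial d (a j))` in ONE pole-free window** — support `(0,1,6)`, rows
`1 − 100x` (pole `10⁻²`, rate 1), `1 + 10x` (slow knee, rate 1), `1 + 10⁻¹⁹x⁶` (fast knee, rate 6), `1 − 10⁻⁵x` (pole `10⁵`, rate 1); the zeros lie in
`(1/50, 10⁴) ⊂ (10⁻², 10⁵)` (IVT ×4 on `wsharpB_signs`).  A located lower-bound datum for the CONJECTURED two-bump law (memo §22.3); proves no upper bound. [this file's theorem] -/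
theorem wronskianSharpTwoBump_slowFast_four_zeros :
    ∃ x₁ x₂ x₃ x₄ : ℝ, 1 / 50 < x₁ ∧ x₁ < x₂ ∧ x₂ < x₃ ∧ x₃ < x₄ ∧ x₄ < 10000 ∧
      ∀ x ∈ ({x₁, x₂, x₃, x₄} : Set ℝ),
        ((∏ j, ∑ l, C ((![![(1 : ℝ), -100, 0], ![1, 10, 0], ![1, 0, 1 / 10 ^ 19], ![1, -1 / 10 ^ 5, 0]] : Fin 4 → Fin 3 → ℝ) j l)
          * X ^ ((![0, 1, 6] : Fin 3 → ℕ) l) : ℝ[X])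
        * (X * derivative (X * derivative (∏ j, ∑ l, C ((![![(1 : ℝ), -100, 0], ![1, 10, 0], ![1, 0, 1 / 10 ^ 19], ![1, -1 / 10 ^ 5, 0]]
            : Fin 4 → Fin 3 → ℝ) j l) * X ^ ((![0, 1, 6] : Fin 3 → ℕ) l) : ℝ[X])))
        - (X * derivative (∏ j, ∑ l, C ((![![(1 : ℝ), -100, 0], ![1, 10, 0], ![1, 0, 1 / 10 ^ 19], ![1, -1 / 10 ^ 5, 0]]
            : Fin 4 → Fin 3 → ℝ) j l) * X ^ ((![0, 1, 6] : Fin 3 → ℕ) l) : ℝ[X])) ^ 2).eval x = 0 := by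
  obtain ⟨hneg, hpos⟩ := wsharpB_signs
  set W : ℝ[X] := ((∏ j, ∑ l, C ((![![(1 : ℝ), -100, 0], ![1, 10, 0], ![1, 0, 1 / 10 ^ 19], ![1, -1 / 10 ^ 5, 0]] : Fin 4 → Fin 3 → ℝ) j l)
          * X ^ ((![0, 1, 6] : Fin 3 → ℕ) l) : ℝ[X])
        * (X * derivative (X * derivative (∏ j, ∑ l, C ((![![(1 : ℝ), -100, 0], ![1, 10, 0], ![1, 0, 1 / 10 ^ 19], ![1, -1 / 10 ^ 5, 0]]
            : Fin 4 → Fin 3 → ℝ) j l) * X ^ ((![0, 1, 6] : Fin 3 → ℕ) l) : ℝ[X])))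
        - (X * derivative (∏ j, ∑ l, C ((![![(1 : ℝ), -100, 0], ![1, 10, 0], ![1, 0, 1 / 10 ^ 19], ![1, -1 / 10 ^ 5, 0]]
            : Fin 4 → Fin 3 → ℝ) j l) * X ^ ((![0, 1, 6] : Fin 3 → ℕ) l) : ℝ[X])) ^ 2) with hWdef
  have hcont : Continuous fun t => W.eval t := W.continuous
  have h1 : W.eval (1 / 50) < 0 := hneg _ (by simp)
  have h2 : 0 < W.eval 1 := hpos _ (by simp)
  have h3 : W.eval 100 < 0 := hneg _ (by simp)
  have h4 : 0 < W.eval 1000 := hpos _ (by simp)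
  have h5 : W.eval 10000 < 0 := hneg _ (by simp)
  obtain ⟨x₁, hx₁, e₁⟩ := intermediate_value_Ioo (show (1 / 50 : ℝ) ≤ 1 by norm_num) hcont.continuousOn ⟨h1, h2⟩
  obtain ⟨x₂, hx₂, e₂⟩ := intermediate_value_Ioo' (show (1 : ℝ) ≤ 100 by norm_num) hcont.continuousOn ⟨h3, h2⟩
  obtain ⟨x₃, hx₃, e₃⟩ := intermediate_value_Ioo (show (100 : ℝ) ≤ 1000 by norm_num) hcont.continuousOn ⟨h3, h4⟩
  obtain ⟨x₄, hx₄, e₄⟩ := intermediate_value_Ioo' (show (1000 : ℝ) ≤ 10000 by norm_num) hcont.continuousOn ⟨h5, h4⟩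
  refine ⟨x₁, x₂, x₃, x₄, hx₁.1, hx₁.2.trans hx₂.1, hx₂.2.trans hx₃.1, hx₃.2.trans hx₄.1, hx₄.2, ?_⟩
  intro x hx
  simp only [Set.mem_insert_iff, Set.mem_singleton_iff] at hx
  rcases hx with rfl | rfl | rfl | rfl
  exacts [e₁, e₂, e₃, e₄]

/-! ### §2 Two fast knees of different rates: `(1 + 10⁻¹x⁶)(x + 10⁻¹⁰x⁶)(1 − 10⁻⁴x)` — four zeros of `W` in the pole-free window `(0, 10⁴)` -/

/-- The rows of the member at a point. [this file's lemma] -/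
theorem wsharpA_rows_eval (t : ℝ) (j : Fin 3) :
    (∑ l, C ((![![(1 : ℝ), 0, 1 / 10], ![0, 1, 1 / 10 ^ 10], ![1, -1 / 10 ^ 4, 0]] : Fin 3 → Fin 3 → ℝ) j l)
        * X ^ ((![0, 1, 6] : Fin 3 → ℕ) l) : ℝ[X]).eval t
      = (![1 + t ^ 6 / 10, t + t ^ 6 / 10 ^ 10, 1 - t / 10 ^ 4] : Fin 3 → ℝ) j := by
  rw [eval_fewnomial]
  fin_cases j
  all_goals (simp [Fin.sum_univ_three]; ring)

/-- The rows' log-Wronskians at a point. [this file's lemma] -/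
theorem wsharpA_rowW_eval (t : ℝ) (j : Fin 3) :
    ((∑ l, C ((![![(1 : ℝ), 0, 1 / 10], ![0, 1, 1 / 10 ^ 10], ![1, -1 / 10 ^ 4, 0]]
            : Fin 3 → Fin 3 → ℝ) j l) * X ^ ((![0, 1, 6] : Fin 3 → ℕ) l) : ℝ[X])
        * (X * derivative (X * derivative (∑ l, C ((![![(1 : ℝ), 0, 1 / 10], ![0, 1, 1 / 10 ^ 10], ![1, -1 / 10 ^ 4, 0]]
            : Fin 3 → Fin 3 → ℝ) j l) * X ^ ((![0, 1, 6] : Fin 3 → ℕ) l) : ℝ[X])))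
        - (X * derivative (∑ l, C ((![![(1 : ℝ), 0, 1 / 10], ![0, 1, 1 / 10 ^ 10], ![1, -1 / 10 ^ 4, 0]]
            : Fin 3 → Fin 3 → ℝ) j l) * X ^ ((![0, 1, 6] : Fin 3 → ℕ) l) : ℝ[X])) ^ 2).eval t
      = (![36 * t ^ 6 / 10, 25 * t ^ 7 / 10 ^ 10, -t / 10 ^ 4] : Fin 3 → ℝ) j := by
  rw [eval_logWronskian_fewnomial]
  fin_cases j <;> (simp [Fin.sum_univ_three]; ring)

/-- **`W(P)(t) = P(t)²·Σ_j W(f_j)(t)/f_j(t)²`** for the member at any `t` where no row vanishes (`0 < t < 10⁴` suffices). [this file's lemma] -/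
theorem wsharpA_W_eval {t : ℝ} (ht0 : 0 < t) (ht : t < 10 ^ 4) :
    ((∏ j, ∑ l, C ((![![(1 : ℝ), 0, 1 / 10], ![0, 1, 1 / 10 ^ 10], ![1, -1 / 10 ^ 4, 0]] : Fin 3 → Fin 3 → ℝ) j l)
          * X ^ ((![0, 1, 6] : Fin 3 → ℕ) l) : ℝ[X])
        * (X * derivative (X * derivative (∏ j, ∑ l, C ((![![(1 : ℝ), 0, 1 / 10], ![0, 1, 1 / 10 ^ 10], ![1, -1 / 10 ^ 4, 0]]
            : Fin 3 → Fin 3 → ℝ) j l) * X ^ ((![0, 1, 6] : Fin 3 → ℕ) l) : ℝ[X])))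
        - (X * derivative (∏ j, ∑ l, C ((![![(1 : ℝ), 0, 1 / 10], ![0, 1, 1 / 10 ^ 10], ![1, -1 / 10 ^ 4, 0]]
            : Fin 3 → Fin 3 → ℝ) j l) * X ^ ((![0, 1, 6] : Fin 3 → ℕ) l) : ℝ[X])) ^ 2).eval t
      = ((1 + t ^ 6 / 10) * (t + t ^ 6 / 10 ^ 10) * (1 - t / 10 ^ 4)) ^ 2
        * ((36 * t ^ 6 / 10) / (1 + t ^ 6 / 10) ^ 2 + (25 * t ^ 7 / 10 ^ 10) / (t + t ^ 6 / 10 ^ 10) ^ 2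
            + (-t / 10 ^ 4) / (1 - t / 10 ^ 4) ^ 2) := by
  have hf : ∀ j, (∑ l, C ((![![(1 : ℝ), 0, 1 / 10], ![0, 1, 1 / 10 ^ 10], ![1, -1 / 10 ^ 4, 0]] : Fin 3 → Fin 3 → ℝ) j l)
        * X ^ ((![0, 1, 6] : Fin 3 → ℕ) l) : ℝ[X]).eval t ≠ 0 := by
    intro j
    rw [wsharpA_rows_eval]
    have h6 : 0 ≤ t ^ 6 := by positivity
    fin_cases j <;> simp <;> intro h <;> nlinarith
  have h := congrArg (Polynomial.eval t) (theta_wronskian_prod (fun j => (∑ l, C ((![![(1 : ℝ), 0, 1 / 10], ![0, 1, 1 / 10 ^ 10], ![1, -1 / 10 ^ 4, 0]]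
      : Fin 3 → Fin 3 → ℝ) j l) * X ^ ((![0, 1, 6] : Fin 3 → ℕ) l) : ℝ[X])))
  rw [eval_finsetSum] at h
  simp only [eval_mul, eval_prod, eval_pow] at h
  rw [h, wronskian_sum_eq_prod_sq_mul _ hf, eval_prod]
  simp only [wsharpA_rows_eval, wsharpA_rowW_eval]
  simp only [Fin.prod_univ_three, Fin.sum_univ_three, Matrix.cons_val_zero, Matrix.cons_val_one, Matrix.cons_val_two,
    Matrix.head_cons, Matrix.tail_cons]

/-- Exact signs of `W(∏ f_j)` at the five points `1 / 1000, 1, 10, 100, 1000`: `− + − + −`. [this file's lemma] -/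
theorem wsharpA_signs :
    (∀ t ∈ ({1 / 1000, 10, 1000} : Set ℝ),
      ((∏ j, ∑ l, C ((![![(1 : ℝ), 0, 1 / 10], ![0, 1, 1 / 10 ^ 10], ![1, -1 / 10 ^ 4, 0]] : Fin 3 → Fin 3 → ℝ) j l)
          * X ^ ((![0, 1, 6] : Fin 3 → ℕ) l) : ℝ[X])
        * (X * derivative (X * derivative (∏ j, ∑ l, C ((![![(1 : ℝ), 0, 1 / 10], ![0, 1, 1 / 10 ^ 10], ![1, -1 / 10 ^ 4, 0]]
            : Fin 3 → Fin 3 → ℝ) j l) * X ^ ((![0, 1, 6] : Fin 3 → ℕ) l) : ℝ[X])))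
        - (X * derivative (∏ j, ∑ l, C ((![![(1 : ℝ), 0, 1 / 10], ![0, 1, 1 / 10 ^ 10], ![1, -1 / 10 ^ 4, 0]]
            : Fin 3 → Fin 3 → ℝ) j l) * X ^ ((![0, 1, 6] : Fin 3 → ℕ) l) : ℝ[X])) ^ 2).eval t < 0) ∧
    (∀ t ∈ ({1, 100} : Set ℝ), 0 <
      ((∏ j, ∑ l, C ((![![(1 : ℝ), 0, 1 / 10], ![0, 1, 1 / 10 ^ 10], ![1, -1 / 10 ^ 4, 0]] : Fin 3 → Fin 3 → ℝ) j l)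
          * X ^ ((![0, 1, 6] : Fin 3 → ℕ) l) : ℝ[X])
        * (X * derivative (X * derivative (∏ j, ∑ l, C ((![![(1 : ℝ), 0, 1 / 10], ![0, 1, 1 / 10 ^ 10], ![1, -1 / 10 ^ 4, 0]]
            : Fin 3 → Fin 3 → ℝ) j l) * X ^ ((![0, 1, 6] : Fin 3 → ℕ) l) : ℝ[X])))
        - (X * derivative (∏ j, ∑ l, C ((![![(1 : ℝ), 0, 1 / 10], ![0, 1, 1 / 10 ^ 10], ![1, -1 / 10 ^ 4, 0]]
            : Fin 3 → Fin 3 → ℝ) j l) * X ^ ((![0, 1, 6] : Fin 3 → ℕ) l) : ℝ[X])) ^ 2).eval t) := by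
  constructor
  · intro t ht
    simp only [Set.mem_insert_iff, Set.mem_singleton_iff] at ht
    rcases ht with rfl | rfl | rfl <;> (rw [wsharpA_W_eval (by norm_num) (by norm_num)]; norm_num)
  · intro t ht
    simp only [Set.mem_insert_iff, Set.mem_singleton_iff] at ht
    rcases ht with rfl | rfl <;> (rw [wsharpA_W_eval (by norm_num) (by norm_num)]; norm_num)

/-- ★ **TWO FAST KNEES OF DIFFERENT RATES ALSO GIVE FOUR: FOUR zeros of `W(∏_j fewnomial d (a j))` in ONE pole-free window** — support `(0,1,6)`,
rows `1 + 10⁻¹x⁶` (knee, rate 6), `x + 10⁻¹⁰x⁶` (knee, rate 5), `1 − 10⁻⁴x` (pole `10⁴`, rate 1); the zeros lie in `(10⁻³, 10³) ⊂ (0, 10⁴)` (IVT ×4 on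
`wsharpA_signs`).  A located lower-bound datum for the CONJECTURED PURE 2N-LAW at N = 2 (memo §22.3); proves no upper bound. [this file's theorem] -/
theorem wronskianSharpTwoBump_fastFast_four_zeros :
    ∃ x₁ x₂ x₃ x₄ : ℝ, 1 / 1000 < x₁ ∧ x₁ < x₂ ∧ x₂ < x₃ ∧ x₃ < x₄ ∧ x₄ < 1000 ∧
      ∀ x ∈ ({x₁, x₂, x₃, x₄} : Set ℝ),
        ((∏ j, ∑ l, C ((![![(1 : ℝ), 0, 1 / 10], ![0, 1, 1 / 10 ^ 10], ![1, -1 / 10 ^ 4, 0]] : Fin 3 → Fin 3 → ℝ) j l)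
          * X ^ ((![0, 1, 6] : Fin 3 → ℕ) l) : ℝ[X])
        * (X * derivative (X * derivative (∏ j, ∑ l, C ((![![(1 : ℝ), 0, 1 / 10], ![0, 1, 1 / 10 ^ 10], ![1, -1 / 10 ^ 4, 0]]
            : Fin 3 → Fin 3 → ℝ) j l) * X ^ ((![0, 1, 6] : Fin 3 → ℕ) l) : ℝ[X])))
        - (X * derivative (∏ j, ∑ l, C ((![![(1 : ℝ), 0, 1 / 10], ![0, 1, 1 / 10 ^ 10], ![1, -1 / 10 ^ 4, 0]]
            : Fin 3 → Fin 3 → ℝ) j l) * X ^ ((![0, 1, 6] : Fin 3 → ℕ) l) : ℝ[X])) ^ 2).eval x = 0 := by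
  obtain ⟨hneg, hpos⟩ := wsharpA_signs
  set W : ℝ[X] := ((∏ j, ∑ l, C ((![![(1 : ℝ), 0, 1 / 10], ![0, 1, 1 / 10 ^ 10], ![1, -1 / 10 ^ 4, 0]] : Fin 3 → Fin 3 → ℝ) j l)
          * X ^ ((![0, 1, 6] : Fin 3 → ℕ) l) : ℝ[X])
        * (X * derivative (X * derivative (∏ j, ∑ l, C ((![![(1 : ℝ), 0, 1 / 10], ![0, 1, 1 / 10 ^ 10], ![1, -1 / 10 ^ 4, 0]]
            : Fin 3 → Fin 3 → ℝ) j l) * X ^ ((![0, 1, 6] : Fin 3 → ℕ) l) : ℝ[X])))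
        - (X * derivative (∏ j, ∑ l, C ((![![(1 : ℝ), 0, 1 / 10], ![0, 1, 1 / 10 ^ 10], ![1, -1 / 10 ^ 4, 0]]
            : Fin 3 → Fin 3 → ℝ) j l) * X ^ ((![0, 1, 6] : Fin 3 → ℕ) l) : ℝ[X])) ^ 2) with hWdef
  have hcont : Continuous fun t => W.eval t := W.continuous
  have h1 : W.eval (1 / 1000) < 0 := hneg _ (by simp)
  have h2 : 0 < W.eval 1 := hpos _ (by simp)
  have h3 : W.eval 10 < 0 := hneg _ (by simp)
  have h4 : 0 < W.eval 100 := hpos _ (by simp)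
  have h5 : W.eval 1000 < 0 := hneg _ (by simp)
  obtain ⟨x₁, hx₁, e₁⟩ := intermediate_value_Ioo (show (1 / 1000 : ℝ) ≤ 1 by norm_num) hcont.continuousOn ⟨h1, h2⟩
  obtain ⟨x₂, hx₂, e₂⟩ := intermediate_value_Ioo' (show (1 : ℝ) ≤ 10 by norm_num) hcont.continuousOn ⟨h3, h2⟩
  obtain ⟨x₃, hx₃, e₃⟩ := intermediate_value_Ioo (show (10 : ℝ) ≤ 100 by norm_num) hcont.continuousOn ⟨h3, h4⟩
  obtain ⟨x₄, hx₄, e₄⟩ := intermediate_value_Ioo' (show (100 : ℝ) ≤ 1000 by norm_num) hcont.continuousOn ⟨h5, h4⟩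
  refine ⟨x₁, x₂, x₃, x₄, hx₁.1, hx₁.2.trans hx₂.1, hx₂.2.trans hx₃.1, hx₃.2.trans hx₄.1, hx₄.2, ?_⟩
  intro x hx
  simp only [Set.mem_insert_iff, Set.mem_singleton_iff] at hx
  rcases hx with rfl | rfl | rfl | rfl
  exacts [e₁, e₂, e₃, e₄]

end ProductPlusOne

end Summit.ValiantsHypothesis.ValiantsHypothesis.Theorems.LacunarySymmetroidMatrixDescartes
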